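import Literature.NumberTheory.ZetaValues.AperyLikeGeneratingFunctionsProved
import Literature.NumberTheory.ZetaValues.TaurasoBivariateProofs
import HarnessLib

/-!
# The Cohen–Rivoal and Tauraso series ARE generating functions of zeta values

Topic `Literature/NumberTheory/ZetaValues`; proofs-only companion of `AperyLikeGeneratingFunctions.lean`, which types
Rivoal's Theorem 1.1 [Rivoal2004, (1–4) p. 504] and Tauraso's (GF2) [Tauraso2020, §1 (2)] with their left-hand sides as
printed (`Σ_{n≥1} n/(n⁴ − a²n² − b⁴)`, `Σ_{k≥1} 1/(k² − ak − b²)`) and records only in prose ("(p. 504; not typed)")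
the sentence that makes them statements about zeta values:

* [Rivoal2004, p. 504, display before Theorem 1.1; Tauraso2020, §1 after (GF1)] "Since the left-hand side of (GF1)
  can be written as the generating function of `ζ(3+2r+4s)`, `Σ_{r≥0} Σ_{s≥0} C(r+s,r) ζ(3+2r+4s) a^{2r} b^{4s}`";
* [Tauraso2020, §1 (GF2)] "where the left-hand side is the generating function of `ζ(2+r+2s)`,
  `Σ_{r≥0} Σ_{s≥0} C(r+s,r) ζ(2+r+2s) aʳ b^{2s}`" (i.e. `= Σ_{k≥1} 1/(k² − ak − b²)`).

This file PROVES both expansions (absolutely convergent on the typed domains `|a|² + |b|⁴ < 1`, resp. `|a| + |b|² < 1`,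
with the tree's real `Literature.NumberTheory.Transcendental.zetaValue`) and composes them with the discharged named
facts `rivoal2004_theorem11_holds`, `tauraso2020_bivariate_holds`: Theorem 1.1 and (GF2) become available literally as
generating-function identities (`rivoal2004_theorem11_generatingFunction`, `tauraso2020_bivariate_generatingFunction`);
the uncited analytic helpers are private.
Proof (elementary; the sources state the expansion without proof): the double binomial–geometric series
`Σ_{r,s≥0} C(r+s,r) uʳ vˢ = 1/(1 − u − v)`, `|u| + |v| < 1` (`hasSum_choose_mul_geometric_two`: fibrewise Mathlib's
`Σ_s C(s+r,r) vˢ = (1−v)^{−r−1}`, then a geometric series in `u/(1−v)`), applied with `u = a²/n²`, `v = b⁴/n⁴` (resp.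
`u = a/k`, `v = b²/k²`); the interchange of `Σ_n` and `Σ_{r,s}` is absolute convergence — the norms sum to
`Σ_n n/(n⁴ − |a|²n² − |b|⁴) ≤ Σ_n 1/((1−ρ)n³)`, `ρ = |a|² + |b|⁴` (resp. `Σ_k 1/((1−ρ)k²)`, `ρ = |a| + |b|²`).
HONEST FRAMING (cells pub-zeta5 / zeta5-irr): IDENTITIES only — generating functions of zeta values equal to fast
Apéry-like series; "truncations of [such] series are not diophantine approximations" [Rivoal2004, p. 503]; nothing here
is an irrationality statement. All sums run over `n + 1`, `n : ℕ`; `C(m,r)` is `Nat.choose`.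
-/

noncomputable section

namespace Literature.NumberTheory.ZetaValues

/-! ### The double binomial–geometric series `Σ_{r,s} C(r+s,r) uʳ vˢ = 1/(1 − u − v)` -/

/-- The fibres of the double series: `Σ_s C(r+s,r) xʳ yˢ = xʳ/(1−y)^{r+1}` for `|y| < 1` (Mathlib's
`hasSum_choose_mul_geometric_of_norm_lt_one`). [folklore] -/
private theorem hasSum_choose_mul_geometric_fibre {𝕜 : Type*} [RCLike 𝕜] (x : 𝕜) {y : 𝕜} (hy : ‖y‖ < 1) (r : ℕ) :
    HasSum (fun s : ℕ => (((r + s).choose r : ℕ) : 𝕜) * x ^ r * y ^ s) (x ^ r * (1 / (1 - y) ^ (r + 1))) := by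
  have h := (hasSum_choose_mul_geometric_of_norm_lt_one r hy).mul_left (x ^ r)
  have hfun : (fun s : ℕ => (((r + s).choose r : ℕ) : 𝕜) * x ^ r * y ^ s) =
      fun s : ℕ => x ^ r * ((((s + r).choose r : ℕ) : 𝕜) * y ^ s) := by
    funext s
    rw [Nat.add_comm r s]
    ring
  rw [hfun]
  exact h

/-- Real, non-negative case: for `0 ≤ x`, `0 ≤ y`, `x + y < 1` the family `C(r+s,r) xʳ yˢ` is summable on `ℕ × ℕ`
(fibrewise `Σ_s C(r+s,r) yˢ = (1−y)^{−r−1}`, then a geometric series of ratio `x/(1−y) < 1`). [folklore] -/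
private theorem summable_choose_mul_geometric_two_real {x y : ℝ} (hx : 0 ≤ x) (hy : 0 ≤ y) (hxy : x + y < 1) :
    Summable fun p : ℕ × ℕ => (((p.1 + p.2).choose p.1 : ℕ) : ℝ) * x ^ p.1 * y ^ p.2 := by
  have hy1 : ‖y‖ < 1 := by rw [Real.norm_of_nonneg hy]; linarith
  have hfib := hasSum_choose_mul_geometric_fibre x hy1
  have h1y : 0 < 1 - y := by linarith
  have hq0 : 0 ≤ x / (1 - y) := div_nonneg hx h1y.le
  have hq1 : x / (1 - y) < 1 := by rw [div_lt_one h1y]; linarith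
  have hg := (summable_geometric_of_lt_one hq0 hq1).mul_left (1 / (1 - y))
  refine (summable_prod_of_nonneg fun p => ?_).2 ⟨fun r => (hfib r).summable, ?_⟩
  · exact mul_nonneg (mul_nonneg (Nat.cast_nonneg _) (pow_nonneg hx _)) (pow_nonneg hy _)
  · refine hg.congr fun r => ?_
    show 1 / (1 - y) * (x / (1 - y)) ^ r = ∑' s : ℕ, (((r + s).choose r : ℕ) : ℝ) * x ^ r * y ^ s
    rw [(hfib r).tsum_eq, div_pow]
    field_simp
    ring

/-- **The double binomial–geometric series**: for `u, v` in `ℝ` or `ℂ` with `|u| + |v| < 1`,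
`Σ_{r,s≥0} C(r+s,r) uʳ vˢ = 1/(1 − u − v)`, absolutely convergent on `ℕ × ℕ`. [folklore] -/
private theorem hasSum_choose_mul_geometric_two {𝕜 : Type*} [RCLike 𝕜] {u v : 𝕜} (huv : ‖u‖ + ‖v‖ < 1) :
    HasSum (fun p : ℕ × ℕ => (((p.1 + p.2).choose p.1 : ℕ) : 𝕜) * u ^ p.1 * v ^ p.2) (1 - u - v)⁻¹ := by
  have hu0 := norm_nonneg u
  have hv0 := norm_nonneg v
  have hv1 : ‖v‖ < 1 := by linarith
  -- absolute convergence
  have hS : Summable fun p : ℕ × ℕ => (((p.1 + p.2).choose p.1 : ℕ) : 𝕜) * u ^ p.1 * v ^ p.2 := by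
    refine Summable.of_norm ((summable_choose_mul_geometric_two_real hu0 hv0 huv).congr fun p => ?_)
    rw [norm_mul, norm_mul, norm_pow, norm_pow, RCLike.norm_natCast]
  -- fibrewise sums
  have hfib := hasSum_choose_mul_geometric_fibre u hv1
  -- the outer geometric series
  have h1v : 1 - ‖v‖ ≤ ‖(1 : 𝕜) - v‖ := by
    have := norm_sub_norm_le (1 : 𝕜) v
    rwa [norm_one] at this
  have h1v0 : (1 : 𝕜) - v ≠ 0 := norm_pos_iff.1 (by linarith)
  have huv1 : (1 : 𝕜) - u - v ≠ 0 := by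
    intro h
    have h' : u = 1 - v := by linear_combination -h
    rw [← h'] at h1v
    linarith
  have hq : ‖u / (1 - v)‖ < 1 := by
    rw [norm_div, div_lt_one (by linarith)]
    linarith
  have hout : HasSum (fun r : ℕ => u ^ r * (1 / (1 - v) ^ (r + 1))) (1 - u - v)⁻¹ := by
    have hg := (hasSum_geometric_of_norm_lt_one hq).mul_left ((1 - v)⁻¹)
    have hfun : (fun r : ℕ => u ^ r * (1 / (1 - v) ^ (r + 1))) = fun r : ℕ => (1 - v)⁻¹ * (u / (1 - v)) ^ r := by
      funext r
      rw [div_pow, pow_succ]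
      field_simp
    have hval : (1 - u - v)⁻¹ = (1 - v)⁻¹ * (1 - u / (1 - v))⁻¹ := by
      rw [← mul_inv]
      congr 1
      field_simp
      ring
    rw [hfun, hval]
    exact hg
  exact (hS.hasSum.prod_fiberwise hfib).unique hout ▸ hS.hasSum

/-! ### Zeta values as the sums over `n` -/

/-- For `k ≥ 2`, `Σ_{n≥0} 1/(n+1)^k = ζ(k)` with the tree's real `zetaValue k = Σ'_{n} 1/n^k` (whose `n = 0` term is
the junk `1/0 = 0`), as a complex `HasSum`. [folklore] -/
private theorem hasSum_one_div_succ_pow_zetaValue {k : ℕ} (hk : 2 ≤ k) :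
    HasSum (fun n : ℕ => 1 / ((n + 1 : ℕ) : ℂ) ^ k)
      ((Literature.NumberTheory.Transcendental.zetaValue k : ℝ) : ℂ) := by
  have hS : Summable fun n : ℕ => 1 / (n : ℝ) ^ k := Real.summable_one_div_nat_pow.2 (by omega)
  have h1 : HasSum (fun n : ℕ => 1 / ((n + 1 : ℕ) : ℝ) ^ k) (Literature.NumberTheory.Transcendental.zetaValue k) := by
    rw [Literature.NumberTheory.Transcendental.zetaValue, hS.tsum_eq_zero_add, Nat.cast_zero, zero_pow (by omega),
      div_zero, zero_add]
    exact ((summable_nat_add_iff 1).2 hS).hasSum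
  have h2 := (Complex.hasSum_ofReal (L := SummationFilter.unconditional ℕ)).2 h1
  convert h2 using 1
  funext n
  push_cast
  rfl

/-- Summability engine for the norm families: a non-negative family on `ℕ × (ℕ × ℕ)` with fibrewise sums `M n` and
`Σ_n M n < ∞` is summable. [folklore] -/
private theorem summable_prod_of_hasSum_fibre {g : ℕ × (ℕ × ℕ) → ℝ} (hg : 0 ≤ g) {M : ℕ → ℝ}
    (hfib : ∀ n : ℕ, HasSum (fun p : ℕ × ℕ => g (n, p)) (M n)) (hM : Summable M) : Summable g := by
  refine (summable_prod_of_nonneg hg).2 ⟨fun n => (hfib n).summable, hM.congr fun n => ?_⟩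
  exact ((hfib n).tsum_eq).symm

/-- **Coefficient extraction engine.** If for every `n` the `n`-th term `L n` of a series expands absolutely as
`L n = Σ_p c(p)/(n+1)^{w(p)}` with all weights `w(p) ≥ 2`, and the whole family of norms is summable on
`ℕ × (ℕ × ℕ)`, then `Σ_p c(p) ζ(w(p)) = Σ_n L n` (absolutely). [folklore] -/
private theorem hasSum_zetaValue_expansion (c : ℕ × ℕ → ℂ) (w : ℕ × ℕ → ℕ) (hw : ∀ p, 2 ≤ w p) (L : ℕ → ℂ)
    (hfib : ∀ n : ℕ, HasSum (fun p : ℕ × ℕ => c p / ((n + 1 : ℕ) : ℂ) ^ w p) (L n))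
    (hnorm : Summable fun q : ℕ × (ℕ × ℕ) => ‖c q.2 / ((q.1 + 1 : ℕ) : ℂ) ^ w q.2‖) :
    HasSum (fun p : ℕ × ℕ => c p * ((Literature.NumberTheory.Transcendental.zetaValue (w p) : ℝ) : ℂ))
      (∑' n : ℕ, L n) := by
  set F : ℕ × (ℕ × ℕ) → ℂ := fun q => c q.2 / ((q.1 + 1 : ℕ) : ℂ) ^ w q.2 with hF_def
  have hF : Summable F := Summable.of_norm hnorm
  -- the sum of the whole family is `Σ_n L n`
  have htot : ∑' q, F q = ∑' n : ℕ, L n := by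
    rw [hF.tsum_prod' fun n => (hfib n).summable]
    exact tsum_congr fun n => (hfib n).tsum_eq
  -- swap the two factors and sum fibrewise over `n` first
  have hFswap : Summable fun q : (ℕ × ℕ) × ℕ => F (Equiv.prodComm (ℕ × ℕ) ℕ q) :=
    (Equiv.prodComm (ℕ × ℕ) ℕ).summable_iff.2 hF
  have hfibn : ∀ p : ℕ × ℕ, HasSum (fun n : ℕ => F (Equiv.prodComm (ℕ × ℕ) ℕ (p, n)))
      (c p * ((Literature.NumberTheory.Transcendental.zetaValue (w p) : ℝ) : ℂ)) := by
    intro p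
    have h := (hasSum_one_div_succ_pow_zetaValue (hw p)).mul_left (c p)
    have hfun : (fun n : ℕ => F (Equiv.prodComm (ℕ × ℕ) ℕ (p, n))) =
        fun n : ℕ => c p * (1 / ((n + 1 : ℕ) : ℂ) ^ w p) := by
      funext n
      show c p / ((n + 1 : ℕ) : ℂ) ^ w p = _
      rw [mul_one_div]
    rw [hfun]
    exact h
  have hcomb := hFswap.hasSum.prod_fiberwise hfibn
  rwa [(Equiv.prodComm (ℕ × ℕ) ℕ).tsum_eq F, htot] at hcomb

/-- `1 ≤ |N|` for `N = n + 1` cast into `ℝ` or `ℂ`. [folklore] -/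
private theorem one_le_norm_natCast_succ {𝕜 : Type*} [RCLike 𝕜] (n : ℕ) : (1 : ℝ) ≤ ‖((n + 1 : ℕ) : 𝕜)‖ := by
  rw [RCLike.norm_natCast]
  exact_mod_cast Nat.succ_le_succ (Nat.zero_le n)

/-- If `|α| + |β| < 1`, `1 ≤ |N|` and `k ≤ m` then `N^m − αN^k − β ≠ 0`, since `|αN^k + β| ≤ (|α|+|β|)|N|^m < |N|^m`.
[folklore] -/
private theorem pow_sub_mul_pow_sub_ne_zero {𝕜 : Type*} [RCLike 𝕜] {α β N : 𝕜} (hαβ : ‖α‖ + ‖β‖ < 1)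
    (hN : (1 : ℝ) ≤ ‖N‖) {k m : ℕ} (hkm : k ≤ m) : N ^ m - α * N ^ k - β ≠ 0 := by
  intro h
  have h' : N ^ m = α * N ^ k + β := by linear_combination h
  have hk : ‖N‖ ^ k ≤ ‖N‖ ^ m := pow_le_pow_right₀ hN hkm
  have hm : (1 : ℝ) ≤ ‖N‖ ^ m := one_le_pow₀ hN
  have h1 : ‖N‖ ^ m ≤ (‖α‖ + ‖β‖) * ‖N‖ ^ m := by
    calc ‖N‖ ^ m = ‖α * N ^ k + β‖ := by rw [← norm_pow, h']
      _ ≤ ‖α‖ * ‖N‖ ^ k + ‖β‖ := by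
          refine (norm_add_le _ _).trans ?_
          rw [norm_mul, norm_pow]
      _ ≤ ‖α‖ * ‖N‖ ^ m + ‖β‖ * ‖N‖ ^ m := by nlinarith [norm_nonneg α, norm_nonneg β]
      _ = (‖α‖ + ‖β‖) * ‖N‖ ^ m := by ring
  have h4 : (0 : ℝ) < ‖N‖ ^ m := by positivity
  nlinarith

/-! ### Rivoal's Theorem 1.1 as the generating function of `ζ(2r+4s+3)` -/

/-- Per-index expansion for [Rivoal2004, (1–4)]: for `N = n+1` and `|α| + |β| < 1` (think `α = a²`, `β = b⁴`),
`N/(N⁴ − αN² − β) = Σ_{r,s≥0} C(r+s,r) αʳ βˢ / N^{2r+4s+3}`, absolutely (in `ℝ` or `ℂ`). [cite: Rivoal2004, p. 504 (display before Theorem 1.1)] -/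
theorem hasSum_rivoal_summand_expansion {𝕜 : Type*} [RCLike 𝕜] (α β : 𝕜) (hαβ : ‖α‖ + ‖β‖ < 1) (n : ℕ) :
    HasSum (fun p : ℕ × ℕ => (((p.1 + p.2).choose p.1 : ℕ) : 𝕜) * α ^ p.1 * β ^ p.2 /
        ((n + 1 : ℕ) : 𝕜) ^ (2 * p.1 + 4 * p.2 + 3))
      (((n + 1 : ℕ) : 𝕜) / (((n + 1 : ℕ) : 𝕜) ^ 4 - α * ((n + 1 : ℕ) : 𝕜) ^ 2 - β)) := by
  set N : 𝕜 := ((n + 1 : ℕ) : 𝕜) with hN_def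
  have hN1 : (1 : ℝ) ≤ ‖N‖ := one_le_norm_natCast_succ n
  have hN0 : N ≠ 0 := norm_pos_iff.1 (by linarith)
  -- `u = α/N²`, `v = β/N⁴`, `|u| + |v| ≤ |α| + |β| < 1`; the denominator `N⁴ − αN² − β` does not vanish
  have hu : ‖α / N ^ 2‖ ≤ ‖α‖ := by
    rw [norm_div, norm_pow]
    exact div_le_self (norm_nonneg α) (one_le_pow₀ hN1)
  have hv : ‖β / N ^ 4‖ ≤ ‖β‖ := by
    rw [norm_div, norm_pow]
    exact div_le_self (norm_nonneg β) (one_le_pow₀ hN1)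
  have huv : ‖α / N ^ 2‖ + ‖β / N ^ 4‖ < 1 := by linarith
  have hD : N ^ 4 - α * N ^ 2 - β ≠ 0 := pow_sub_mul_pow_sub_ne_zero hαβ hN1 (by norm_num)
  have h := (hasSum_choose_mul_geometric_two huv).mul_left (1 / N ^ 3)
  have hfun : (fun p : ℕ × ℕ => (((p.1 + p.2).choose p.1 : ℕ) : 𝕜) * α ^ p.1 * β ^ p.2 /
      N ^ (2 * p.1 + 4 * p.2 + 3)) =
      fun p : ℕ × ℕ => 1 / N ^ 3 * ((((p.1 + p.2).choose p.1 : ℕ) : 𝕜) * (α / N ^ 2) ^ p.1 * (β / N ^ 4) ^ p.2) := by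
    funext p
    rw [div_pow, div_pow, ← pow_mul, ← pow_mul]
    field_simp
    ring
  have hval : N / (N ^ 4 - α * N ^ 2 - β) = 1 / N ^ 3 * (1 - α / N ^ 2 - β / N ^ 4)⁻¹ := by
    have h1 : 1 - α / N ^ 2 - β / N ^ 4 = (N ^ 4 - α * N ^ 2 - β) / N ^ 4 := by
      field_simp
    rw [h1, inv_div]
    field_simp
  rw [hfun, hval]
  exact h

/-- **Rivoal 2004, the left-hand side of Theorem 1.1 is the generating function of `ζ(2r+4s+3)`**: for complex `a, b`
with `|a|² + |b|⁴ < 1`, `Σ_{r,s≥0} C(r+s,r) ζ(2r+4s+3) a^{2r} b^{4s} = Σ_{n≥1} n/(n⁴ − a²n² − b⁴)`, the double series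
converging absolutely (tree's real `zetaValue`). [cite: Rivoal2004, p. 504 (display before Theorem 1.1)]
[cite: Tauraso2020, §1 (display after (GF1))] -/
theorem rivoal2004_lhs_hasSum_zetaValue (a b : ℂ) (hab : ‖a‖ ^ 2 + ‖b‖ ^ 4 < 1) :
    HasSum (fun p : ℕ × ℕ => (((p.1 + p.2).choose p.1 : ℕ) : ℂ) *
        ((Literature.NumberTheory.Transcendental.zetaValue (2 * p.1 + 4 * p.2 + 3) : ℝ) : ℂ) *
        a ^ (2 * p.1) * b ^ (4 * p.2))
      (∑' n : ℕ, ((n + 1 : ℕ) : ℂ) / (((n + 1 : ℕ) : ℂ) ^ 4 - a ^ 2 * ((n + 1 : ℕ) : ℂ) ^ 2 - b ^ 4)) := by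
  have habC : ‖a ^ 2‖ + ‖b ^ 4‖ < 1 := by rwa [norm_pow, norm_pow]
  have habR : ‖(‖a‖ ^ 2 : ℝ)‖ + ‖(‖b‖ ^ 4 : ℝ)‖ < 1 := by
    rwa [Real.norm_of_nonneg (by positivity), Real.norm_of_nonneg (by positivity)]
  -- summability of the norms: fibrewise the REAL expansion, then `Σ_n N/(N⁴ − |a|²N² − |b|⁴) ≤ Σ_n 1/((1−ρ)N³)`
  set ρ : ℝ := ‖a‖ ^ 2 + ‖b‖ ^ 4 with hρ_def
  have hM : Summable fun n : ℕ =>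
      ((n + 1 : ℕ) : ℝ) / (((n + 1 : ℕ) : ℝ) ^ 4 - ‖a‖ ^ 2 * ((n + 1 : ℕ) : ℝ) ^ 2 - ‖b‖ ^ 4) := by
    have hρ1 : 0 < 1 - ρ := by linarith
    have h3 : Summable fun n : ℕ => 1 / (1 - ρ) * (1 / ((n + 1 : ℕ) : ℝ) ^ 3) :=
      ((summable_nat_add_iff 1).mpr (Real.summable_one_div_nat_pow.mpr (by norm_num : 1 < 3))).mul_left _
    -- the denominator dominates `(1 − ρ) N⁴`
    have hD : ∀ n : ℕ, (1 - ρ) * ((n + 1 : ℕ) : ℝ) ^ 4 ≤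
        ((n + 1 : ℕ) : ℝ) ^ 4 - ‖a‖ ^ 2 * ((n + 1 : ℕ) : ℝ) ^ 2 - ‖b‖ ^ 4 := by
      intro n
      have hN1 : (1 : ℝ) ≤ ((n + 1 : ℕ) : ℝ) := by exact_mod_cast Nat.succ_le_succ (Nat.zero_le n)
      have h2 : ((n + 1 : ℕ) : ℝ) ^ 2 ≤ ((n + 1 : ℕ) : ℝ) ^ 4 := pow_le_pow_right₀ hN1 (by norm_num)
      have h4 : (1 : ℝ) ≤ ((n + 1 : ℕ) : ℝ) ^ 4 := one_le_pow₀ hN1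
      rw [hρ_def]
      nlinarith [mul_nonneg (pow_nonneg (norm_nonneg a) 2) (sub_nonneg.2 h2),
        mul_nonneg (pow_nonneg (norm_nonneg b) 4) (sub_nonneg.2 h4)]
    have hDpos : ∀ n : ℕ, (0 : ℝ) < (1 - ρ) * ((n + 1 : ℕ) : ℝ) ^ 4 := fun n => by positivity
    refine Summable.of_nonneg_of_le (fun n => div_nonneg (Nat.cast_nonneg _) ((hDpos n).le.trans (hD n)))
      (fun n => ?_) h3
    have hN0 : ((n + 1 : ℕ) : ℝ) ≠ 0 := by positivity
    calc ((n + 1 : ℕ) : ℝ) / (((n + 1 : ℕ) : ℝ) ^ 4 - ‖a‖ ^ 2 * ((n + 1 : ℕ) : ℝ) ^ 2 - ‖b‖ ^ 4)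
        ≤ ((n + 1 : ℕ) : ℝ) / ((1 - ρ) * ((n + 1 : ℕ) : ℝ) ^ 4) :=
          div_le_div_of_nonneg_left (Nat.cast_nonneg _) (hDpos n) (hD n)
      _ = 1 / (1 - ρ) * (1 / ((n + 1 : ℕ) : ℝ) ^ 3) := by
          field_simp
  have hnorm : Summable fun q : ℕ × (ℕ × ℕ) =>
      ‖(((q.2.1 + q.2.2).choose q.2.1 : ℕ) : ℂ) * (a ^ 2) ^ q.2.1 * (b ^ 4) ^ q.2.2 /
        ((q.1 + 1 : ℕ) : ℂ) ^ (2 * q.2.1 + 4 * q.2.2 + 3)‖ := by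
    have hg := summable_prod_of_hasSum_fibre (g := fun q : ℕ × (ℕ × ℕ) =>
        (((q.2.1 + q.2.2).choose q.2.1 : ℕ) : ℝ) * (‖a‖ ^ 2) ^ q.2.1 * (‖b‖ ^ 4) ^ q.2.2 /
          ((q.1 + 1 : ℕ) : ℝ) ^ (2 * q.2.1 + 4 * q.2.2 + 3))
      (fun q => by positivity) (fun n => hasSum_rivoal_summand_expansion (‖a‖ ^ 2) (‖b‖ ^ 4) habR n) hM
    refine hg.congr fun q => ?_
    rw [norm_div, norm_mul, norm_mul, norm_pow, norm_pow, norm_pow, norm_pow, norm_pow, Complex.norm_natCast,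
      Complex.norm_natCast]
  have hmain := hasSum_zetaValue_expansion
    (fun p : ℕ × ℕ => (((p.1 + p.2).choose p.1 : ℕ) : ℂ) * (a ^ 2) ^ p.1 * (b ^ 4) ^ p.2)
    (fun p => 2 * p.1 + 4 * p.2 + 3) (fun p => by omega) _
    (fun n => hasSum_rivoal_summand_expansion (a ^ 2) (b ^ 4) habC n) hnorm
  convert hmain using 2 with p
  rw [pow_mul, pow_mul]
  ring

/-- **Rivoal 2004, Theorem 1.1, as printed — "simultaneous generation of Koecher's and Almkvist–Granville's
formulae"**: for complex `a, b` with `|a|² + |b|⁴ < 1`,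
`Σ_{r,s≥0} C(r+s,r) ζ(2r+4s+3) a^{2r} b^{4s}
  = ½ Σ_{k≥1} ((−1)^{k+1}/C(2k,k)) (1/k) (5k²−a²)/(k⁴−a²k²−b⁴) ∏_{n<k} ((n²−a²)²+4b⁴)/(n⁴−a²n²−b⁴)`
(the right-hand side is `½ Σ_k rivoalTerm a b k`; composition of `rivoal2004_lhs_hasSum_zetaValue` with the discharged
named fact `rivoal2004_theorem11_holds`). [cite: Rivoal2004, Theorem 1.1 p. 504] -/
theorem rivoal2004_theorem11_generatingFunction (a b : ℂ) (hab : ‖a‖ ^ 2 + ‖b‖ ^ 4 < 1) :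
    HasSum (fun p : ℕ × ℕ => (((p.1 + p.2).choose p.1 : ℕ) : ℂ) *
        ((Literature.NumberTheory.Transcendental.zetaValue (2 * p.1 + 4 * p.2 + 3) : ℝ) : ℂ) *
        a ^ (2 * p.1) * b ^ (4 * p.2))
      ((1 / 2 : ℂ) * ∑' k : ℕ, rivoalTerm a b (k + 1)) := by
  have h := rivoal2004_lhs_hasSum_zetaValue a b hab
  rwa [rivoal2004_theorem11_holds a b hab] at h

/-! ### Tauraso's (GF2) as the generating function of `ζ(2+r+2s)` -/

/-- Per-index expansion for [Tauraso2020, (2)]: for `N = k+1` and `|α| + |β| < 1` (think `α = a`, `β = b²`),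
`1/(N² − αN − β) = Σ_{r,s≥0} C(r+s,r) αʳ βˢ / N^{r+2s+2}`, absolutely (in `ℝ` or `ℂ`). [cite: Tauraso2020, §1 (2)] -/
theorem hasSum_tauraso_summand_expansion {𝕜 : Type*} [RCLike 𝕜] (α β : 𝕜) (hαβ : ‖α‖ + ‖β‖ < 1) (n : ℕ) :
    HasSum (fun p : ℕ × ℕ => (((p.1 + p.2).choose p.1 : ℕ) : 𝕜) * α ^ p.1 * β ^ p.2 /
        ((n + 1 : ℕ) : 𝕜) ^ (p.1 + 2 * p.2 + 2))
      (1 / (((n + 1 : ℕ) : 𝕜) ^ 2 - α * ((n + 1 : ℕ) : 𝕜) - β)) := by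
  set N : 𝕜 := ((n + 1 : ℕ) : 𝕜) with hN_def
  have hN1 : (1 : ℝ) ≤ ‖N‖ := one_le_norm_natCast_succ n
  have hN0 : N ≠ 0 := norm_pos_iff.1 (by linarith)
  -- `u = α/N`, `v = β/N²`, `|u| + |v| ≤ |α| + |β| < 1`; the denominator `N² − αN − β` does not vanish
  have hu : ‖α / N‖ ≤ ‖α‖ := by
    rw [norm_div]
    exact div_le_self (norm_nonneg α) hN1
  have hv : ‖β / N ^ 2‖ ≤ ‖β‖ := by
    rw [norm_div, norm_pow]
    exact div_le_self (norm_nonneg β) (one_le_pow₀ hN1)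
  have huv : ‖α / N‖ + ‖β / N ^ 2‖ < 1 := by linarith
  have hD : N ^ 2 - α * N - β ≠ 0 := by
    simpa using pow_sub_mul_pow_sub_ne_zero hαβ hN1 (k := 1) (m := 2) (by norm_num)
  have h := (hasSum_choose_mul_geometric_two huv).mul_left (1 / N ^ 2)
  have hfun : (fun p : ℕ × ℕ => (((p.1 + p.2).choose p.1 : ℕ) : 𝕜) * α ^ p.1 * β ^ p.2 /
      N ^ (p.1 + 2 * p.2 + 2)) =
      fun p : ℕ × ℕ => 1 / N ^ 2 * ((((p.1 + p.2).choose p.1 : ℕ) : 𝕜) * (α / N) ^ p.1 * (β / N ^ 2) ^ p.2) := by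
    funext p
    rw [div_pow, div_pow, ← pow_mul]
    field_simp
    ring
  have hval : 1 / (N ^ 2 - α * N - β) = 1 / N ^ 2 * (1 - α / N - β / N ^ 2)⁻¹ := by
    have h1 : 1 - α / N - β / N ^ 2 = (N ^ 2 - α * N - β) / N ^ 2 := by
      field_simp
    rw [h1, inv_div]
    field_simp
  rw [hfun, hval]
  exact h

/-- **Tauraso 2020, the left-hand side of (GF2) is the generating function of `ζ(2+r+2s)`**: for complex `a, b` with
`|a| + |b|² < 1`, `Σ_{r,s≥0} C(r+s,r) ζ(2+r+2s) aʳ b^{2s} = Σ_{k≥1} 1/(k² − ak − b²)`, the double series converging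
absolutely (tree's real `zetaValue`; `a = 0`: the Bailey–Borwein–Bradley generating function of `ζ(2s+2)`).
[cite: Tauraso2020, §1 (2)] -/
theorem tauraso2020_lhs_hasSum_zetaValue (a b : ℂ) (hab : ‖a‖ + ‖b‖ ^ 2 < 1) :
    HasSum (fun p : ℕ × ℕ => (((p.1 + p.2).choose p.1 : ℕ) : ℂ) *
        ((Literature.NumberTheory.Transcendental.zetaValue (p.1 + 2 * p.2 + 2) : ℝ) : ℂ) *
        a ^ p.1 * b ^ (2 * p.2))
      (∑' k : ℕ, 1 / (((k + 1 : ℕ) : ℂ) ^ 2 - a * ((k + 1 : ℕ) : ℂ) - b ^ 2)) := by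
  have habC : ‖a‖ + ‖b ^ 2‖ < 1 := by rwa [norm_pow]
  have habR : ‖(‖a‖ : ℝ)‖ + ‖(‖b‖ ^ 2 : ℝ)‖ < 1 := by
    rwa [Real.norm_of_nonneg (norm_nonneg a), Real.norm_of_nonneg (by positivity)]
  set ρ : ℝ := ‖a‖ + ‖b‖ ^ 2 with hρ_def
  have hM : Summable fun n : ℕ =>
      1 / (((n + 1 : ℕ) : ℝ) ^ 2 - ‖a‖ * ((n + 1 : ℕ) : ℝ) - ‖b‖ ^ 2) := by
    have hρ1 : 0 < 1 - ρ := by linarith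
    have h3 : Summable fun n : ℕ => 1 / (1 - ρ) * (1 / ((n + 1 : ℕ) : ℝ) ^ 2) :=
      ((summable_nat_add_iff 1).mpr (Real.summable_one_div_nat_pow.mpr (by norm_num : 1 < 2))).mul_left _
    -- the denominator dominates `(1 − ρ) N²`
    have hD : ∀ n : ℕ, (1 - ρ) * ((n + 1 : ℕ) : ℝ) ^ 2 ≤
        ((n + 1 : ℕ) : ℝ) ^ 2 - ‖a‖ * ((n + 1 : ℕ) : ℝ) - ‖b‖ ^ 2 := by
      intro n
      have hN1 : (1 : ℝ) ≤ ((n + 1 : ℕ) : ℝ) := by exact_mod_cast Nat.succ_le_succ (Nat.zero_le n)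
      have h2 : ((n + 1 : ℕ) : ℝ) ≤ ((n + 1 : ℕ) : ℝ) ^ 2 := by nlinarith
      have h4 : (1 : ℝ) ≤ ((n + 1 : ℕ) : ℝ) ^ 2 := one_le_pow₀ hN1
      rw [hρ_def]
      nlinarith [mul_nonneg (norm_nonneg a) (sub_nonneg.2 h2), mul_nonneg (pow_nonneg (norm_nonneg b) 2) (sub_nonneg.2 h4)]
    have hDpos : ∀ n : ℕ, (0 : ℝ) < (1 - ρ) * ((n + 1 : ℕ) : ℝ) ^ 2 := fun n => by positivity
    refine Summable.of_nonneg_of_le (fun n => div_nonneg zero_le_one ((hDpos n).le.trans (hD n)))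
      (fun n => ?_) h3
    have hN0 : ((n + 1 : ℕ) : ℝ) ≠ 0 := by positivity
    calc 1 / (((n + 1 : ℕ) : ℝ) ^ 2 - ‖a‖ * ((n + 1 : ℕ) : ℝ) - ‖b‖ ^ 2)
        ≤ 1 / ((1 - ρ) * ((n + 1 : ℕ) : ℝ) ^ 2) := div_le_div_of_nonneg_left zero_le_one (hDpos n) (hD n)
      _ = 1 / (1 - ρ) * (1 / ((n + 1 : ℕ) : ℝ) ^ 2) := by
          field_simp
  have hnorm : Summable fun q : ℕ × (ℕ × ℕ) =>
      ‖(((q.2.1 + q.2.2).choose q.2.1 : ℕ) : ℂ) * a ^ q.2.1 * (b ^ 2) ^ q.2.2 /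
        ((q.1 + 1 : ℕ) : ℂ) ^ (q.2.1 + 2 * q.2.2 + 2)‖ := by
    have hg := summable_prod_of_hasSum_fibre (g := fun q : ℕ × (ℕ × ℕ) =>
        (((q.2.1 + q.2.2).choose q.2.1 : ℕ) : ℝ) * ‖a‖ ^ q.2.1 * (‖b‖ ^ 2) ^ q.2.2 /
          ((q.1 + 1 : ℕ) : ℝ) ^ (q.2.1 + 2 * q.2.2 + 2))
      (fun q => by positivity) (fun n => hasSum_tauraso_summand_expansion (‖a‖) (‖b‖ ^ 2) habR n) hM
    refine hg.congr fun q => ?_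
    rw [norm_div, norm_mul, norm_mul, norm_pow, norm_pow, norm_pow, norm_pow, Complex.norm_natCast,
      Complex.norm_natCast]
  have hmain := hasSum_zetaValue_expansion
    (fun p : ℕ × ℕ => (((p.1 + p.2).choose p.1 : ℕ) : ℂ) * a ^ p.1 * (b ^ 2) ^ p.2)
    (fun p => p.1 + 2 * p.2 + 2) (fun p => by omega) _
    (fun n => hasSum_tauraso_summand_expansion a (b ^ 2) habC n) hnorm
  convert hmain using 2 with p
  rw [pow_mul]
  ring

/-- **Tauraso 2020, (GF2) as printed**: for complex `a, b` with `|a| + |b|² < 1`,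
`Σ_{r,s≥0} C(r+s,r) ζ(2+r+2s) aʳ b^{2s} = Σ_{k≥1} ((3k−a)/(k C(2k,k))) ∏_{j<k}(j² − a² − 4b²)/∏_{j≤k}(j² − aj − b²)`
(composition of `tauraso2020_lhs_hasSum_zetaValue` with the discharged named fact `tauraso2020_bivariate_holds`).
[cite: Tauraso2020, §1 (2)] -/
theorem tauraso2020_bivariate_generatingFunction (a b : ℂ) (hab : ‖a‖ + ‖b‖ ^ 2 < 1) :
    HasSum (fun p : ℕ × ℕ => (((p.1 + p.2).choose p.1 : ℕ) : ℂ) *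
        ((Literature.NumberTheory.Transcendental.zetaValue (p.1 + 2 * p.2 + 2) : ℝ) : ℂ) *
        a ^ p.1 * b ^ (2 * p.2))
      (∑' k : ℕ, (3 * ((k + 1 : ℕ) : ℂ) - a) / (((k + 1 : ℕ) : ℂ) * ((k + 1).centralBinom : ℂ)) *
        ((∏ j ∈ Finset.Ico 1 (k + 1), ((j : ℂ) ^ 2 - a ^ 2 - 4 * b ^ 2)) /
          ∏ j ∈ Finset.Icc 1 (k + 1), ((j : ℂ) ^ 2 - a * (j : ℂ) - b ^ 2))) := by
  have h := tauraso2020_lhs_hasSum_zetaValue a b hab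
  rwa [tauraso2020_bivariate_holds a b hab] at h

end Literature.NumberTheory.ZetaValues
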